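import Mathlib
import Literature.Computability.Complexity.RangeAvoidance

/-!
# The cut-norm certificate for pure-CAND range avoidance (p2 Lemma C.8, typed)

FRONTIER F-N1c (`CandMatchAvoidLinearFP`, stmt-PneNP-19962 / `CandAvoidLinearFP`, stmt-PneNP-20226);
nothing here bears on P vs NP.

For a pure-CAND 3-local map `I` (output `j` is `x(c_j) ⊕ (x(a_j) ∧ x(b_j))`, roles `c_j = vars j 0`,
`a_j = vars j 1`, `b_j = vars j 2`) and a candidate point `y ∈ {0,1}^m`, write `χ b = (-1)^b ∈ {1,-1}`.
* `cand_preimage_sum_ge`: at every preimage `x` of `y`,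
  `∑_j χ(y_j)·χ(x c_j)·(1 + χ(x a_j) + χ(x b_j)) ≥ m` (each term is `1` or `3`).
* `cand_cut_certificate`: consequently, if the bilinear ("cut-norm") functional
  `∑_j χ(y_j)·σ(c_j)·(φ₀ + φ(a_j) + φ(b_j))` is `< m` for ALL `±1` vectors `σ, φ` and `φ₀ = 1`, then
  `y ∉ Range(I)`.
This is the interface between any certificate-producing algorithm (spectral / SDP / derandomised signing,
cf. pnp-ideate ROUND-15 «sfm-bl») and the avoidance statement. Elementary (an 8-case truth table).
-/

namespace Summit.PneNP.PneNP.Theorems.CandCutNorm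

open Finset Literature.Computability.Complexity

/-- `χ b = (-1)^b`: the `±1` value of a Boolean. -/
def boolSign (b : Bool) : ℤ := if b then -1 else 1

/-- `χ b ∈ {1, -1}`. -/
theorem boolSign_eq_one_or (b : Bool) : boolSign b = 1 ∨ boolSign b = -1 := by
  cases b <;> simp [boolSign]

/-- The truth-table fact behind the certificate: for the CAND output `y = c ⊕ (a ∧ b)`,
`χ(y)·χ(c)·(1 + χ(a) + χ(b))` equals `3` if `a = b = false` and `1` otherwise; in particular it is `≥ 1`. -/
theorem cand_term_ge_one (a b c : Bool) :
    (1 : ℤ) ≤ boolSign (xor c (a && b)) * boolSign c * (1 + boolSign a + boolSign b) := by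
  cases a <;> cases b <;> cases c <;> simp [boolSign]

/-- **Preimage inequality.** For a pure-CAND instance and any input `x`, with `y = I.eval x`:
`m ≤ ∑_j χ(y_j)·χ(x c_j)·(1 + χ(x a_j) + χ(x b_j))`. -/
theorem cand_preimage_sum_ge {n m : ℕ} (I : LocalMap 3 n m) (hI : I.IsPure candPred)
    (x : Fin n → Bool) :
    (m : ℤ) ≤ ∑ j, boolSign (I.eval x j) * boolSign (x (I.vars j 0))
      * (1 + boolSign (x (I.vars j 1)) + boolSign (x (I.vars j 2))) := by
  have hterm : ∀ j, (1 : ℤ) ≤ boolSign (I.eval x j) * boolSign (x (I.vars j 0))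
      * (1 + boolSign (x (I.vars j 1)) + boolSign (x (I.vars j 2))) := by
    intro j
    have htab : I.table j = candPred := hI.1 j
    have hev : I.eval x j = xor (x (I.vars j 0)) (x (I.vars j 1) && x (I.vars j 2)) := by
      simp [LocalMap.eval, htab, candPred]
    rw [hev]
    exact cand_term_ge_one _ _ _
  calc (m : ℤ) = ∑ _j : Fin m, (1 : ℤ) := by simp
    _ ≤ _ := Finset.sum_le_sum (fun j _ => hterm j)

/-- **Cut-norm certificate (p2 Lemma C.8).** If for every pair of `±1` vectors `σ, φ` on the variables
the functional `∑_j χ(y_j)·σ(c_j)·(1 + φ(a_j) + φ(b_j))` is `< m`, then `y` is outside the range of the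
pure-CAND instance `I`. (Only `σ = φ = χ ∘ x` is used; the hypothesis over independent `σ, φ` is the form
that spectral / cut-norm bounds deliver.) -/
theorem cand_cut_certificate {n m : ℕ} (I : LocalMap 3 n m) (hI : I.IsPure candPred)
    (y : Fin m → Bool)
    (hcert : ∀ (σ φ : Fin n → ℤ), (∀ i, σ i = 1 ∨ σ i = -1) → (∀ i, φ i = 1 ∨ φ i = -1) →
      ∑ j, boolSign (y j) * σ (I.vars j 0) * (1 + φ (I.vars j 1) + φ (I.vars j 2)) < (m : ℤ)) :
    y ∉ I.range := by
  rintro ⟨x, hx⟩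
  have h := hcert (fun i => boolSign (x i)) (fun i => boolSign (x i))
    (fun i => boolSign_eq_one_or _) (fun i => boolSign_eq_one_or _)
  have hge := cand_preimage_sum_ge I hI x
  rw [hx] at hge
  exact absurd h (not_lt.mpr hge)

/-- The same certificate with a free sign `φ₀ ∈ {±1}` on the constant term (the form used when the
constant vertex is split into pieces): `∑_j χ(y_j)·σ(c_j)·(φ₀ + φ(a_j) + φ(b_j)) < m` for all `±1`
data `σ, φ, φ₀` implies `y ∉ Range(I)`. -/
theorem cand_cut_certificate' {n m : ℕ} (I : LocalMap 3 n m) (hI : I.IsPure candPred)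
    (y : Fin m → Bool)
    (hcert : ∀ (σ φ : Fin n → ℤ) (φ₀ : ℤ), (∀ i, σ i = 1 ∨ σ i = -1) → (∀ i, φ i = 1 ∨ φ i = -1) →
      (φ₀ = 1 ∨ φ₀ = -1) →
      ∑ j, boolSign (y j) * σ (I.vars j 0) * (φ₀ + φ (I.vars j 1) + φ (I.vars j 2)) < (m : ℤ)) :
    y ∉ I.range :=
  cand_cut_certificate I hI y (fun σ φ hσ hφ => by simpa using hcert σ φ 1 hσ hφ (Or.inl rfl))

end Summit.PneNP.PneNP.Theorems.CandCutNorm
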